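import Summits.BirchSwinnertonDyer.BirchSwinnertonDyer.Theses.TameQuarticManinParity
import Summits.BirchSwinnertonDyer.BirchSwinnertonDyer.Theorems.TameQuarticManinParityTwistPairAtThree
import HarnessLib

/-!
# Route `TameQuarticManinParity`, LINE 41 (bsd-idea-3 g11), glue G41irr `TprimeIrrThreeDvdDegreeOfCells`
# (stmt-BirchSwinnertonDyer-24077) — PROVED BY NAME (the planner's `Sketch41.g41irr`)

Cell `pub/bsd-wall`, D-0145 line `route-BirchSwinnertonDyer-TeichmullerTwistDescent`, seat `bsd-line-ttd-p1` g15,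
working the planner-of-record's TQMP LINE 41. BSD is NOT proved by this; Manin's conjecture is not proved by this;
the two Galois-free CELL statements E57′ (`TprimeTameStarredOptimalManinUnit`, stmt-24046) and E41
(`TprimeTameThreeOptimalManinUnit`, stmt-24070) stay OPEN, hence so does the irreducible organ
`TprimeIrrManinUnitOfThreeDvdDegree` (24498). This file closes ONLY the glue.

## Statement (verbatim the route decl)

`TprimeTameStarredOptimalManinUnit → TprimeTameThreeOptimalManinUnit → TprimeIrrManinUnitOfThreeDvdDegree`.

## Proof

Split the (t′) rows by `ord₃ Δ_min ∈ {3, 9}` (`TwistPairAtThree.padicValInt_eq_three_or_nine_of_subTprime`): E41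
serves the Kodaira-III rows, E57′ the III* rows; the ¬CM / irreducibility binders are unused. Pure logic. Design:
theorems only; no definition, no named fact, no `sorry`; axioms `propext`, `Classical.choice`, `Quot.sound`.
-/

set_option autoImplicit false
-- D-0017: single-problem summit, so `Summit.BirchSwinnertonDyer.BirchSwinnertonDyer.…` repeats a namespace BY DESIGN.
set_option linter.dupNamespace false

namespace Summit.BirchSwinnertonDyer.BirchSwinnertonDyer.Theorems.TameQuarticManinParity

open Summit.BirchSwinnertonDyer.BirchSwinnertonDyer.Theses.TameQuarticManinParity

/-- **Glue G41irr** (stmt-BirchSwinnertonDyer-24077), by name: the III*-cell statement E57′ and the III-cell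
statement E41 give the irreducible organ `TprimeIrrManinUnitOfThreeDvdDegree`, by the landed dichotomy
`ord₃ Δ_min ∈ {3, 9}` on the (t′) cell. [cite: SilvermanATAEC1994, IV.9.4 and Table 4.1] -/
theorem tprimeIrrThreeDvdDegreeOfCells_proof : TprimeIrrThreeDvdDegreeOfCells := by
  unfold TprimeIrrThreeDvdDegreeOfCells TprimeIrrManinUnitOfThreeDvdDegree
  intro h57 h41 W _ _ _ _hCM hadd ht _hirr D hL hopt h3deg
  rcases TwistPairAtThree.padicValInt_eq_three_or_nine_of_subTprime W hadd ht with h3 | h9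
  · exact h41 W hadd ht h3 D hL hopt h3deg
  · exact h57 W hadd ht h9 D hL hopt

end Summit.BirchSwinnertonDyer.BirchSwinnertonDyer.Theorems.TameQuarticManinParity
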